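import Literature.AnabelianGeometry.SemiGraphs.PSCCoveringBranchData
import Literature.AnabelianGeometry.SemiGraphs.PSCCoveringDatumProofs
import Literature.AnabelianGeometry.SemiGraphs.PSCGraphicity
import Mathlib.Topology.Algebra.ClopenNhdofOne
import HarnessLib

/-!
# Covering-closed origins have unbounded vertex counts ([CombGC] Def. 1.1 (ii), Prop. 1.2 (i)) — a vacuity audit of bounded-shape origins

Mochizuki, *A combinatorial version of the Grothendieck conjecture* [CombGC], Tohoku Math. J. **59**
(2007), §1, Definition 1.1 (i)–(ii), author's manuscript pp. 6–7 [cite: MochizukiCombGC2007, Def 1.1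
pp.6-7]: a finite étale covering `G' → G` of a semi-graph of anabelioids of pro-Σ PSC-type "that
arises from an open subgroup of `Π_G`" is again of pro-Σ PSC-type — a pointed stable curve with a
finite étale covering of its dual semi-graph of anabelioids is again a pointed stable curve — and its
vertices over `v` are the double cosets `Π_{G'} \ Π_G / Π_v`.

In the tree this closure property of the geometric origin is the origin-level statement
`RestrictBDOfPSCTypeHolds Ω` (`PSCCoveringBranchData.lean`, the REPAIRED form of Def. 1.1 (ii)): for
every `Ω`-datum `G` there are branch data `bd` such that every covering datum `G.restrictBD U hU bd`
(`U ⊆ Π_G` open of finite index) is again an `Ω`-datum.  It is one of the thirteen named origin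
statements under which the cell's kernels of [CombGC] Thm. 1.6 (ii)/(iii) for general `Σ`
(`PSCThm16iiGeneralSigmaProofs`, `PSCThm16iiiGeneralSigmaProofs`) are derived.

This PROOF-ONLY file (no definitions) records an elementary STRUCTURAL CONSEQUENCE of that closure
property, and the resulting VACUITY AUDIT of "small" origins:

* `exists_openNormal_graph_i_lt_vertCount`: if `Π_G` is profinite and ONE verticial subgroup
  `Π_v ≠ Π_G`, then some open normal subgroup `U` has `i(G_U) = vertCount U ≥ i(G) + 1` (take `U`
  inside the open neighbourhood `{g | x⁻¹ g ∉ Π_v}` of `1`, `x ∉ Π_v`: then `U·1·Π_v ≠ U·x·Π_v`);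
* `exists_restrictBD_mem_graph_i_lt` (R1): hence a covering-closed origin (`RestrictBDOfPSCTypeHolds Ω`)
  containing such a datum contains a datum with MORE vertices;
* `exists_mem_le_graph_i` (R2): with Prop. 1.2 (i) (`OpenInterDeterminesComponentHolds Ω`, row F-0459:
  two distinct vertices cannot both have `Π_v = Π_G`) and ONE `Ω`-datum with `i ≥ 2` on a profinite
  group, `Ω` contains data with `i ≥ N` for EVERY `N`;
* `not_restrictBD_and_openInter_of_graph_i_le` (R3): consequently NO origin all of whose data have
  vertex count `≤ B` and which contains one datum with `i ≥ 2` on a profinite group satisfies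
  `RestrictBDOfPSCTypeHolds Ω ∧ OpenInterDeterminesComponentHolds Ω`; and where Prop. 1.2 (i) is KNOWN
  at such an origin (e.g. the two-component-shape origins of `PSCTwoComponentShape.lean`,
  `exists_twoComponentOrigin_holds`), `RestrictBDOfPSCTypeHolds Ω` is FALSE
  (`not_restrictBDOfPSCTypeHolds_of_openInter`); `not_restrictBDOfPSCTypeHolds_of_vertGp_ne_top` is
  the hopen-free form at a maximal-vertex-count datum with a proper verticial subgroup.

CONSEQUENCE FOR THE CELL'S NON-VACUITY CENSUS («witnessed ≠ inhabited»): every origin of record at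
which the general-`Σ` Theorem 1.6 kernels were instantiated with more than one vertex — the `Ω` of
`generalSigma_scope_inhabited` / `generalSigma_nonVacuity` (`PSCThm16GeneralSigmaNonVacuity.lean`,
row PSC-NV-Σ: all data have `i = 2`, profinite, inhabited on a `ProfiniteGrp`) — CANNOT satisfy the
displayed hypothesis pair `hres ∧ hopen` (resp. `hres ∧ h12`) of those instantiations: the two
implication-conjuncts of `generalSigma_nonVacuity` have jointly unsatisfiable antecedents at that `Ω`
(`not_restrictBD_and_openInter_of_graph_i_eq_two`, stated over exactly the conjuncts that theorem
exports).  The only origin of record at which all thirteen inputs are jointly witnessed remains the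
one-vertex origin `Ω_scg` (`PSCSmoothCurveGenuineOrigin.lean`), where (ii)/(iii) are degenerate.  An
honest multi-vertex non-vacuity origin must contain data with unboundedly many vertices, i.e. be
genuinely closed under finite étale coverings (the geometric `Ω₀`).  This is consistent with — indeed
an instance of — the geometry: the coverings of a stable curve with two components have unboundedly
many components.  Nothing here takes a side on [IUTchIII] Cor. 3.12; typed ≠ proved; a vacuity audit
refutes no printed statement.
-/

noncomputable section

namespace Literature.AnabelianGeometry.SemiGraphs

namespace PSCDatum

open scoped Pointwise

universe u

variable {P : Type u} [Group P] [TopologicalSpace P] [IsTopologicalGroup P]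

/-! ### One proper verticial subgroup forces a covering with more vertices -/

/-- **Two double cosets.**  If `Π_G` is profinite and the (closed) verticial subgroup `Π_v` is not all
of `Π_G`, there is an open normal subgroup `U ⊆ Π_G` and an `x ∈ Π_G` with `U·1·Π_v ≠ U·x·Π_v`: take
`x ∉ Π_v` and `U` inside the open neighbourhood `{g | x⁻¹ g ∉ Π_v}` of `1`
(`ProfiniteGrp.exist_openNormalSubgroup_sub_open_nhds_of_one`). [cite: MochizukiCombGC2007, Def 1.1(ii) p.6] -/
theorem exists_openNormal_doubleCoset_ne [CompactSpace P] [TotallyDisconnectedSpace P]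
    (G : PSCDatum P) {v : G.graph.V} (hv : G.vertGp v ≠ ⊤) :
    ∃ (U : OpenNormalSubgroup P) (x : P),
      DoubleCoset.mk (U.toSubgroup) (G.vertGp v) (1 : P) ≠ DoubleCoset.mk (U.toSubgroup) (G.vertGp v) x := by
  obtain ⟨x, hx⟩ : ∃ x : P, x ∉ G.vertGp v := by
    by_contra h
    exact hv (eq_top_iff.mpr fun y _ => by_contra fun hy => h ⟨y, hy⟩)
  set W : Set P := (fun g : P => x⁻¹ * g) ⁻¹' ((G.vertGp v : Set P)ᶜ) with hW
  have hWo : IsOpen W := (G.isClosed_vertGp v).isOpen_compl.preimage (by fun_prop)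
  have h1W : (1 : P) ∈ W := by
    simp only [hW, Set.mem_preimage, mul_one, Set.mem_compl_iff, SetLike.mem_coe, inv_mem_iff]
    exact hx
  obtain ⟨U, hU⟩ := ProfiniteGrp.exist_openNormalSubgroup_sub_open_nhds_of_one hWo h1W
  refine ⟨U, x, fun h => ?_⟩
  rw [DoubleCoset.eq] at h
  obtain ⟨u, hu, k, hk, hxuk⟩ := h
  have huW : u ∈ W := hU hu
  simp only [hW, Set.mem_preimage, Set.mem_compl_iff, SetLike.mem_coe] at huW
  apply huW
  have : x⁻¹ * u = k⁻¹ := by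
    rw [hxuk, mul_one, mul_inv_rev, inv_mul_cancel_right]
  rw [this]
  exact inv_mem hk

/-- **Vertex growth at one covering.**  If `Π_G` is profinite and `Π_v ≠ Π_G` for one vertex `v`, then
for some open normal subgroup `U` the covering `G_U` has at least `i(G) + 1` vertices:
`vertCount U = Σ_w #(U \ Π_G / Π_w) ≥ 2 + (i(G) − 1)`. [cite: MochizukiCombGC2007, Def 1.1(ii) p.6] -/
theorem exists_openNormal_graph_i_lt_vertCount [CompactSpace P] [TotallyDisconnectedSpace P]
    (G : PSCDatum P) {v : G.graph.V} (hv : G.vertGp v ≠ ⊤) :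
    ∃ U : OpenNormalSubgroup P, G.graph.i + 1 ≤ G.vertCount U.toSubgroup := by
  classical
  obtain ⟨U, x, hx⟩ := G.exists_openNormal_doubleCoset_ne hv
  refine ⟨U, ?_⟩
  haveI : U.toSubgroup.FiniteIndex := by
    haveI := Subgroup.quotient_finite_of_isOpen U.toSubgroup U.toOpenSubgroup.isOpen
    exact Subgroup.finiteIndex_of_finite_quotient
  haveI hfin : ∀ w : G.graph.V,
      Finite (DoubleCoset.Quotient (U.toSubgroup : Set P) (G.vertGp w : Set P)) :=
    fun w => PSCCovering.finite_doubleCosetQuotient _ _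
  -- pointwise lower bound: `2` at `v`, `1` elsewhere
  have hpt : ∀ w : G.graph.V, (if w = v then 2 else 1) ≤
      Nat.card (DoubleCoset.Quotient (U.toSubgroup : Set P) (G.vertGp w : Set P)) := by
    intro w
    split_ifs with hw
    · subst hw
      haveI : Nontrivial (DoubleCoset.Quotient (U.toSubgroup : Set P) (G.vertGp w : Set P)) :=
        ⟨⟨_, _, hx⟩⟩
      exact Finite.one_lt_card
    · haveI : Nonempty (DoubleCoset.Quotient (U.toSubgroup : Set P) (G.vertGp w : Set P)) :=
        ⟨DoubleCoset.mk U.toSubgroup (G.vertGp w) 1⟩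
      exact Nat.card_pos
  calc G.graph.i + 1 = ∑ w : G.graph.V, (if w = v then 2 else 1) := by
        have h2 : ∀ w : G.graph.V, (if w = v then 2 else 1 : ℕ) = 1 + (if w = v then 1 else 0) := by
          intro w; split_ifs <;> rfl
        simp only [h2, Finset.sum_add_distrib, Finset.sum_const, Finset.card_univ, smul_eq_mul,
          mul_one, Finset.sum_ite_eq', Finset.mem_univ, if_true]
        rfl
    _ ≤ G.vertCount U.toSubgroup := Finset.sum_le_sum fun w _ => hpt w

/-- `i(G_U) = vertCount U` for the covering datum built from branch data (its vertices are those of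
`restrictGraph`). [cite: MochizukiCombGC2007, Def 1.1(i)-(ii) p.6] -/
theorem restrictBD_graph_i (G : PSCDatum P) (U : Subgroup P) [U.FiniteIndex]
    (hU : IsOpen (U : Set P)) (bd : G.BranchData) :
    (G.restrictBD U hU bd).graph.i = G.vertCount U :=
  G.restrictGraph_i U

/-! ### (R1) Covering-closed origins: one proper verticial subgroup ⇒ a datum with more vertices -/

/-- **(R1) Vertex growth in a covering-closed origin.**  If `Ω` satisfies the repaired Def. 1.1 (ii)
closure statement `RestrictBDOfPSCTypeHolds Ω` and contains a datum `G` on a profinite group with a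
verticial subgroup `Π_v ≠ Π_G`, then `Ω` contains a covering datum `G_U = G.restrictBD U hU bd` with
`i(G_U) ≥ i(G) + 1`. [cite: MochizukiCombGC2007, Def 1.1(ii) p.6] -/
theorem exists_restrictBD_mem_graph_i_lt (Ω : PSCOrigin.{u}) (hres : RestrictBDOfPSCTypeHolds Ω)
    [CompactSpace P] [TotallyDisconnectedSpace P] (G : PSCDatum P) (hG : Ω.IsOfPSCType G)
    {v : G.graph.V} (hv : G.vertGp v ≠ ⊤) :
    ∃ (U : Subgroup P) (_ : U.FiniteIndex) (hU : IsOpen (U : Set P)) (bd : G.BranchData),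
      Ω.IsOfPSCType (G.restrictBD U hU bd) ∧ G.graph.i + 1 ≤ (G.restrictBD U hU bd).graph.i := by
  obtain ⟨bd, hbd⟩ := hres G hG
  obtain ⟨U, hcount⟩ := G.exists_openNormal_graph_i_lt_vertCount hv
  haveI : U.toSubgroup.FiniteIndex := by
    haveI := Subgroup.quotient_finite_of_isOpen U.toSubgroup U.toOpenSubgroup.isOpen
    exact Subgroup.finiteIndex_of_finite_quotient
  exact ⟨U.toSubgroup, inferInstance, U.toOpenSubgroup.isOpen, bd, hbd U.toSubgroup _,
    by rwa [restrictBD_graph_i]⟩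

/-! ### (R2) With Prop. 1.2 (i): unbounded vertex counts -/

omit [IsTopologicalGroup P] in
/-- **Prop. 1.2 (i) forbids two improper verticial subgroups.**  If `G` satisfies the verticial case
of Prop. 1.2 (i) (`VerticialOpenInterDeterminesVertex`) and `v₀ ≠ v₁`, then `Π_{v₀} ≠ Π_G` or
`Π_{v₁} ≠ Π_G` (else `Π_{v₀} ∩ Π_{v₁} = Π_G` is open in `Π_{v₀}`, forcing `v₀ = v₁`).
[cite: MochizukiCombGC2007, Prop 1.2(i) p.8] -/
theorem vertGp_ne_top_or_of_openInter (G : PSCDatum P) (h : G.VerticialOpenInterDeterminesVertex)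
    {v₀ v₁ : G.graph.V} (hne : v₀ ≠ v₁) : G.vertGp v₀ ≠ ⊤ ∨ G.vertGp v₁ ≠ ⊤ := by
  by_contra hc
  simp only [not_or, ne_eq, not_not] at hc
  obtain ⟨h0, h1⟩ := hc
  apply hne
  apply h v₀ v₁ 1 1
  have htop : ((1 : ConjAct P) • G.vertGp v₀ ⊓ (1 : ConjAct P) • G.vertGp v₁).subgroupOf
      ((1 : ConjAct P) • G.vertGp v₀) = ⊤ := by
    have h1' : (1 : ConjAct P) • G.vertGp v₁ = ⊤ := by rw [one_smul]; exact h1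
    rw [Subgroup.subgroupOf_eq_top, h1']
    exact le_inf le_rfl le_top
  rw [htop]
  simp

omit [IsTopologicalGroup P] in
/-- A datum with at least two vertices has two distinct vertices. [cite: MochizukiCombGC2007, Def 1.1(i) p.6] -/
theorem exists_ne_of_two_le_graph_i (G : PSCDatum P) (h2 : 2 ≤ G.graph.i) :
    ∃ v₀ v₁ : G.graph.V, v₀ ≠ v₁ :=
  Fintype.exists_pair_of_one_lt_card h2

/-- **(R2) Unbounded vertex counts.**  If `Ω` is covering-closed (`RestrictBDOfPSCTypeHolds Ω`),
satisfies Prop. 1.2 (i) (`OpenInterDeterminesComponentHolds Ω`), and contains ONE datum with at least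
two vertices on a profinite group, then for every `N` it contains a datum (on a profinite group) with
at least `N` vertices.  Induction: a datum with `≥ 2` vertices has a proper verticial subgroup
(`vertGp_ne_top_or_of_openInter`), hence a covering in `Ω` — on the open subgroup `U`, again
profinite — with more vertices (`exists_restrictBD_mem_graph_i_lt`). [cite: MochizukiCombGC2007, Def 1.1(ii) p.6] -/
theorem exists_mem_le_graph_i (Ω : PSCOrigin.{u}) (hres : RestrictBDOfPSCTypeHolds Ω)
    (hopen : OpenInterDeterminesComponentHolds Ω)
    [CompactSpace P] [TotallyDisconnectedSpace P] (G : PSCDatum P) (hG : Ω.IsOfPSCType G)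
    (h2 : 2 ≤ G.graph.i) (N : ℕ) :
    ∃ (Q : Type u) (_ : Group Q) (_ : TopologicalSpace Q) (_ : IsTopologicalGroup Q)
      (_ : CompactSpace Q) (_ : TotallyDisconnectedSpace Q) (K : PSCDatum Q),
      Ω.IsOfPSCType K ∧ N ≤ K.graph.i := by
  suffices hmain : ∀ N : ℕ, ∃ (Q : Type u) (_ : Group Q) (_ : TopologicalSpace Q)
      (_ : IsTopologicalGroup Q) (_ : CompactSpace Q) (_ : TotallyDisconnectedSpace Q) (K : PSCDatum Q),
      Ω.IsOfPSCType K ∧ N ≤ K.graph.i ∧ 2 ≤ K.graph.i by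
    obtain ⟨Q, _, _, _, _, _, K, hK, hN, -⟩ := hmain N
    exact ⟨Q, ‹_›, ‹_›, ‹_›, ‹_›, ‹_›, K, hK, hN⟩
  intro N
  induction N with
  | zero => exact ⟨P, ‹_›, ‹_›, ‹_›, ‹_›, ‹_›, G, hG, Nat.zero_le _, h2⟩
  | succ N ih =>
    obtain ⟨Q, _, _, _, _, _, K, hK, hN, hK2⟩ := ih
    obtain ⟨v₀, v₁, hne⟩ := K.exists_ne_of_two_le_graph_i hK2
    have hv : ∃ v : K.graph.V, K.vertGp v ≠ ⊤ := by
      rcases K.vertGp_ne_top_or_of_openInter (hopen K hK).1 hne with h | h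
      exacts [⟨v₀, h⟩, ⟨v₁, h⟩]
    obtain ⟨v, hv⟩ := hv
    obtain ⟨U, _, hU, bd, hmem, hgrow⟩ := K.exists_restrictBD_mem_graph_i_lt Ω hres hK hv
    haveI : CompactSpace U :=
      isCompact_iff_compactSpace.mp (U.isClosed_of_isOpen hU).isCompact
    exact ⟨U, inferInstance, inferInstance, inferInstance, inferInstance, inferInstance,
      K.restrictBD U hU bd, hmem, by omega, by omega⟩

/-! ### (R3) Vacuity audit: bounded-shape origins are not covering-closed -/

/-- **(R3) No bounded-vertex-count origin with a multi-vertex datum is covering-closed and satisfies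
Prop. 1.2 (i).**  If every `Ω`-datum (on a topological group) has at most `B` vertices and `Ω`
contains a datum with at least two vertices on a profinite group, then
`¬ (RestrictBDOfPSCTypeHolds Ω ∧ OpenInterDeterminesComponentHolds Ω)`.
[cite: MochizukiCombGC2007, Def 1.1(ii) p.6] -/
theorem not_restrictBD_and_openInter_of_graph_i_le (Ω : PSCOrigin.{u}) (B : ℕ)
    (hB : ∀ ⦃Q : Type u⦄ [Group Q] [TopologicalSpace Q] [IsTopologicalGroup Q] (K : PSCDatum Q),
      Ω.IsOfPSCType K → K.graph.i ≤ B)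
    [CompactSpace P] [TotallyDisconnectedSpace P] (G : PSCDatum P) (hG : Ω.IsOfPSCType G)
    (h2 : 2 ≤ G.graph.i) :
    ¬ (RestrictBDOfPSCTypeHolds Ω ∧ OpenInterDeterminesComponentHolds Ω) := by
  rintro ⟨hres, hopen⟩
  obtain ⟨Q, _, _, _, _, _, K, hK, hN⟩ := G.exists_mem_le_graph_i Ω hres hopen hG h2 (B + 1)
  have := hB K hK
  omega

/-- **(R3′) Where Prop. 1.2 (i) is known, covering-closure fails.**  At an origin with bounded vertex
counts, a multi-vertex datum on a profinite group, and `OpenInterDeterminesComponentHolds Ω` (row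
F-0459 — e.g. PROVED at the two-component-shape origins of `exists_twoComponentOrigin_holds`), the
repaired Def. 1.1 (ii) statement `RestrictBDOfPSCTypeHolds Ω` is FALSE: such an `Ω` is not closed
under finite étale coverings. [cite: MochizukiCombGC2007, Def 1.1(ii) p.6] -/
theorem not_restrictBDOfPSCTypeHolds_of_openInter (Ω : PSCOrigin.{u}) (B : ℕ)
    (hB : ∀ ⦃Q : Type u⦄ [Group Q] [TopologicalSpace Q] [IsTopologicalGroup Q] (K : PSCDatum Q),
      Ω.IsOfPSCType K → K.graph.i ≤ B)
    (hopen : OpenInterDeterminesComponentHolds Ω)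
    [CompactSpace P] [TotallyDisconnectedSpace P] (G : PSCDatum P) (hG : Ω.IsOfPSCType G)
    (h2 : 2 ≤ G.graph.i) : ¬ RestrictBDOfPSCTypeHolds Ω :=
  fun hres => G.not_restrictBD_and_openInter_of_graph_i_le Ω B hB hG h2 ⟨hres, hopen⟩

/-- **(R3″) hopen-free form.**  If `G ∈ Ω` (profinite) has the MAXIMAL vertex count among `Ω`-data and
one proper verticial subgroup `Π_v ≠ Π_G`, then `Ω` is not covering-closed.
[cite: MochizukiCombGC2007, Def 1.1(ii) p.6] -/
theorem not_restrictBDOfPSCTypeHolds_of_vertGp_ne_top (Ω : PSCOrigin.{u})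
    [CompactSpace P] [TotallyDisconnectedSpace P] (G : PSCDatum P) (hG : Ω.IsOfPSCType G)
    (hmax : ∀ ⦃Q : Type u⦄ [Group Q] [TopologicalSpace Q] [IsTopologicalGroup Q] (K : PSCDatum Q),
      Ω.IsOfPSCType K → K.graph.i ≤ G.graph.i)
    {v : G.graph.V} (hv : G.vertGp v ≠ ⊤) : ¬ RestrictBDOfPSCTypeHolds Ω := by
  intro hres
  obtain ⟨U, _, hU, bd, hmem, hgrow⟩ := G.exists_restrictBD_mem_graph_i_lt Ω hres hG hv
  have := hmax _ hmem
  omega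

/-- **(R3) at the shape exported by the general-`Σ` non-vacuity files.**  For every origin `Ω` all of
whose data have exactly two vertices (the first two exported conjuncts of
`generalSigma_scope_inhabited` give `i = 2`, `n = 1`, `r = 0` and profiniteness) and which is
inhabited on a profinite group (its third conjunct), the displayed hypotheses
`hres : RestrictBDOfPSCTypeHolds Ω` and `hopen`/`h12 : OpenInterDeterminesComponentHolds Ω` of
`generalSigma_nonVacuity` are JOINTLY UNSATISFIABLE: those implication-conjuncts are vacuous as typed.
[cite: MochizukiCombGC2007, Def 1.1(ii) p.6] -/
theorem not_restrictBD_and_openInter_of_graph_i_eq_two (Ω : PSCOrigin.{u})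
    (hi : ∀ ⦃Q : Type u⦄ [Group Q] [TopologicalSpace Q] [IsTopologicalGroup Q] (K : PSCDatum Q),
      Ω.IsOfPSCType K → K.graph.i = 2)
    [CompactSpace P] [TotallyDisconnectedSpace P] (G : PSCDatum P) (hG : Ω.IsOfPSCType G) :
    ¬ (RestrictBDOfPSCTypeHolds Ω ∧ OpenInterDeterminesComponentHolds Ω) :=
  G.not_restrictBD_and_openInter_of_graph_i_le Ω 2 (fun _ _ _ _ K hK => (hi K hK).le) hG
    (hi G hG).ge

end PSCDatum

end Literature.AnabelianGeometry.SemiGraphs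

end
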